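import Summits.QuantumFields.BalabanUV.T4Continuum.Spine.NE7.QLaBlockAvgTwoLevelPrintKind
import Summits.QuantumFields.BalabanUV.T4Continuum.Spine.NE7.NodeSAtDatumOfRecord
import Summits.QuantumFields.BalabanUV.T4Continuum.Spine.NE7.QLaConeNeighbourhood

/-!
# Spine/NE7/NodeSAtDatumOfRecordPrintKind — NODE S's averaging-side chain AT NODE 00's DATUM OF RECORD (Stage 0) ON PRINT-KIND
# DOMAINS: `IsDatumOfRecord₀ F N D` ⟹ `HolDevBound (D.av K) domPK e θ`, `LoopDefectBound (D.av K) domPK (e²∕2) θ`, the `domPrintedPK`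
# forms, and the chain END TO END (log-quotient `t`-discrepancy) on `domPK` — files 51∕52's certificates keyed to the object node's
# predicate, as file 47∕50 keyed generation 8's

Cell `pub-balaban-gaps` (YM blitz Y1, track G2, seat `ne7`, generation 14); text of record
`run/shared/lean/pub/pub-balaban-gaps/ne/NE7.md` (census R80).  Fifty-third `Spine/NE7/` file; 0 `def`, 0 sorry; [bookkeeping]
compositions BY NAME.

WHY.  Files 47∕48∕50 (generation 13) state NODE S's averaging-side input at NODE 00's Stage-0 datum predicate
`Node00.IsDatumOfRecord₀` (`D.av = avOfRecord F N = blockAvg expMeanLogSU`) on generation 8's domain families `dom` ∕ `domPrinted`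
(shrink factor `16ℓ` ∕ `71|S_d|ℓ` per level).  Files 51∕52 (this generation) moved the certificates to PRINT-KIND domains `domPK` ∕
`domPrintedPK` (shrink factor `L` per level, the base of [Balaban1985Averaging] (158); census R61's caveat discharged, R80).  This
file is the one-line re-keying a Stage-5 consumer would otherwise do by hand: §1 the four shapes at every datum of record and every
cutoff on `domPK` ∕ `domPrintedPK`; §2 the same for the bare averaging of record `avOfRecord F N K`; §3 NODE S's chain END TO END on
`domPK` — for ANY two probability laws read into `domPK`-configurations trivial off a finite bond set `Λ` with one-bond deviations
`≤ Dm`, every closed walk `w` of `T^{(k+n)}` and every `t`: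
`|log ∫e^{t(W−1)}dν₁ − log ∫e^{t(W−1)}dν₂| ≤ 2|t|·(e²∕2)·(|w|·|Λ|·Dm)²·(θ²)ⁿ`, `W` = the loop observable of the datum's OWN `n`-fold
average (the twin of file 29's `abs_log_quotient_sub_le_blockAvgSU` ∕ file 50's `abs_log_quotient_sub_le_of_isDatumOfRecord₀`, with
the larger admissible support for the laws); §4 the NEAR-SUPPORT cone bound of files 41 ∕ 43 ∕ 48 on `domPrintedPK` — for the
headline's class (`loopDefect_le_of_near_support_printKind`, file 43's statement with `domPrinted ⊆ domPrintedPK` in place of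
`domPrinted`) and at the datum of record: only the bonds of `Λ` within `(d+2)(L^{k+n} − L^k)` finest units of the walk are charged.

HONEST FRAMING.  The Stage-0 predicate constrains ONLY the datum's averaging maps; Bałaban's `R`, the β-input and the (2.18) [III]
densities are NOT constrained or constructed (NODE 00 Stage 5) — so this is NODE S's AVERAGING-SIDE input at the object node's
predicate on print-kind domains, nothing more; the per-entry W-fmt data (α)–(γ) remain the object node's.  [bookkeeping]; nothing of
Bałaban's asserted beyond print; NE7 NOT proved; spine 0∕9; one fixed finite T⁴ — NOT ℝ⁴, NOT infinite volume, NOT a mass gap, NOT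
Clay.  No classification word moves (R10).
-/

noncomputable section

open MeasureTheory

namespace Summit.QuantumFields.BalabanUV.T4Continuum.Spine.NE7

open Literature.MathematicalPhysics.QuantumFieldTheory.Balaban1983to89
open Literature.MathematicalPhysics.QuantumFieldTheory.Balaban1983to89.T4Continuum
open Literature.MathematicalPhysics.QuantumFieldTheory.Balaban1983to89.T4Continuum.FiniteEpsData
open Literature.MathematicalPhysics.QuantumFieldTheory.Balaban1983to89.T4AvgSensitivity
open Literature.MathematicalPhysics.QuantumFieldTheory.Balaban1983to89.T4AvgDerivBound
open Literature.MathematicalPhysics.QuantumFieldTheory.Balaban1983to89.BlockAveraging (blockAvg)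
open Literature.MathematicalPhysics.QuantumFieldTheory.Balaban1983to89.ExpMeanLog (expMeanLogSU)
open Literature.MathematicalPhysics.QuantumFieldTheory.Balaban1983to89.Node00
  (avOfRecord IsDatumOfRecord₀ isPrintedAveraged₁_of_av isPrintedAveraged_of_isDatumOfRecord₀)
open Literature.MathematicalPhysics.QuantumFieldTheory.Balaban1983to89.B15DeterminingSets (embIter)

variable {F : T4Family} {N : ℕ} [NeZero N]

/-! ## §1 At every datum of record (Stage 0), on the print-kind domains -/

/-- **NODE S's HOLONOMY-LEVEL INPUT AT THE DATUM OF RECORD ON PRINT-KIND DOMAINS**: for every finite-`ε` datum `D` over `SU(N)` with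
`IsDatumOfRecord₀ F N D` and every cutoff `K`, `HolDevBound (D.av K) domPK e θ` — file 52's `holDevBound_of_isPrintedAveraged₁_printKind`
at NODE 00's `isPrintedAveraged₁_of_av`. [bookkeeping] -/
theorem holDevBound_domPK_of_isDatumOfRecord₀ (D : FiniteEpsData F (Matrix.specialUnitaryGroup (Fin N) ℂ))
    (hD : IsDatumOfRecord₀ F N D) (K : ℕ) :
    HolDevBound (D.av K) (domPK (F.P K) (Fin N)) (Real.exp 1) (theta (F.P K)) :=
  holDevBound_of_isPrintedAveraged₁_printKind D (isPrintedAveraged₁_of_av F N D hD) K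

/-- … and the second-order LOOP-DEFECT bound (constant `e²∕2`) at the datum of record on `domPK`. [bookkeeping] -/
theorem loopDefectBound_domPK_of_isDatumOfRecord₀ (D : FiniteEpsData F (Matrix.specialUnitaryGroup (Fin N) ℂ))
    (hD : IsDatumOfRecord₀ F N D) (K : ℕ) :
    LoopDefectBound (D.av K) (domPK (F.P K) (Fin N)) (1 / 2 * Real.exp 1 ^ 2) (theta (F.P K)) :=
  loopDefectBound_of_holDevBound reTrCrit_specialUnitaryGroup (by norm_num) (holDevBound_domPK_of_isDatumOfRecord₀ D hD K)

/-- The headline-class form on the common print-kind family `domPrintedPK = domPK ∩ domPK₂` at the datum of record. [bookkeeping] -/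
theorem holDevBound_domPrintedPK_of_isDatumOfRecord₀ (D : FiniteEpsData F (Matrix.specialUnitaryGroup (Fin N) ℂ))
    (hD : IsDatumOfRecord₀ F N D) (K : ℕ) :
    HolDevBound (D.av K) (domPrintedPK (F.P K) (Fin N)) (Real.exp 1) (theta (F.P K)) :=
  holDevBound_of_isPrintedAveraged_printKind D (isPrintedAveraged_of_isDatumOfRecord₀ F N D hD) K

/-- … and `LoopDefectBound` on `domPrintedPK` at the datum of record. [bookkeeping] -/
theorem loopDefectBound_domPrintedPK_of_isDatumOfRecord₀ (D : FiniteEpsData F (Matrix.specialUnitaryGroup (Fin N) ℂ))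
    (hD : IsDatumOfRecord₀ F N D) (K : ℕ) :
    LoopDefectBound (D.av K) (domPrintedPK (F.P K) (Fin N)) (1 / 2 * Real.exp 1 ^ 2) (theta (F.P K)) :=
  loopDefectBound_of_isPrintedAveraged_printKind D (isPrintedAveraged_of_isDatumOfRecord₀ F N D hD) K

/-! ## §2 For the bare averaging operations of record -/

/-- `HolDevBound` ON `domPK` for NODE 00's averaging operations of record themselves, on every torus `F.P K` (file 51's
`holDevBound_blockAvgSU_printKind`; `avOfRecord F N K = fun j => blockAvg expMeanLogSU` definitionally). [bookkeeping] -/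
theorem holDevBound_avOfRecord_printKind (K : ℕ) :
    HolDevBound (avOfRecord F N K) (domPK (F.P K) (Fin N)) (Real.exp 1) (theta (F.P K)) :=
  holDevBound_blockAvgSU_printKind

/-- `LoopDefectBound` ON `domPK` for the averaging operations of record (file 51's `loopDefectBound_blockAvgSU_printKind`). [bookkeeping] -/
theorem loopDefectBound_avOfRecord_printKind (K : ℕ) :
    LoopDefectBound (avOfRecord F N K) (domPK (F.P K) (Fin N)) (1 / 2 * Real.exp 1 ^ 2) (theta (F.P K)) :=
  loopDefectBound_blockAvgSU_printKind

/-! ## §3 NODE S's chain END TO END at the datum of record, on the print-kind domains -/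

/-- **NODE S's CHAIN END TO END AT THE DATUM OF RECORD ON PRINT-KIND DOMAINS**: for every datum `D` with `IsDatumOfRecord₀ F N D`, every
cutoff `K`, ANY two probability laws `ν₁, ν₂` read into level-`k` configurations lying in `domPK` and trivial off a finite bond set `Λ`
with one-bond deviations `≤ Dm`, every closed walk `w` of `T^{(k+n)}` and every source strength `t`:
`|log ∫e^{t(W−1)}dν₁ − log ∫e^{t(W−1)}dν₂| ≤ 2|t|·(e²∕2)·(|w|·|Λ|·Dm)²·(θ²)ⁿ`, `W` = `Re tr∕N` of the holonomy of the datum's OWN `n`-fold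
average along `w`, `θ = L^{1−d}` (`loopDefect_le_of_support` on file 52∕§1's `LoopDefectBound`, then `abs_log_integral_exp_sub_le`).
No property of the laws beyond the support is used; the FORMAT (W-fmt@1) and the census of `Λ` stay with NODE 00 ∕ file 44.
[bookkeeping] -/
theorem abs_log_quotient_sub_le_domPK_of_isDatumOfRecord₀ (D : FiniteEpsData F (Matrix.specialUnitaryGroup (Fin N) ℂ))
    (hD : IsDatumOfRecord₀ F N D) (K : ℕ) {Ω : Type*} [MeasurableSpace Ω] (ν₁ ν₂ : Measure Ω)
    [IsProbabilityMeasure ν₁] [IsProbabilityMeasure ν₂] {k n : ℕ} (hn : k + n ≤ (F.P K).m + (F.P K).K)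
    (x : Site (F.P K) (k + n)) (w : List (T4Continuum.Letter (F.P K).d)) (hw : walkEnd x w = x)
    (cfg : Ω → GaugeField (F.P K) k (Matrix.specialUnitaryGroup (Fin N) ℂ)) (hdom : ∀ ω, cfg ω ∈ domPK (F.P K) (Fin N) k)
    (Λ : Finset (PBond (F.P K) k)) {Dm : ℝ} (hoff : ∀ ω b, b ∉ Λ → cfg ω b = 1) (hDm : ∀ ω, ∀ b ∈ Λ, dist1 (cfg ω b) ≤ Dm)
    (hG₁ : AEStronglyMeasurable (fun ω => loopAt (iterFrom (D.av K) k n (cfg ω)) (walk x w) - 1) ν₁)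
    (hG₂ : AEStronglyMeasurable (fun ω => loopAt (iterFrom (D.av K) k n (cfg ω)) (walk x w) - 1) ν₂) (t : ℝ) :
    |Real.log (∫ ω, Real.exp (t * (loopAt (iterFrom (D.av K) k n (cfg ω)) (walk x w) - 1)) ∂ν₁)
      - Real.log (∫ ω, Real.exp (t * (loopAt (iterFrom (D.av K) k n (cfg ω)) (walk x w) - 1)) ∂ν₂)|
      ≤ 2 * (|t| * (1 / 2 * Real.exp 1 ^ 2 * ((w.length : ℝ) * Λ.card * Dm) ^ 2 * (theta (F.P K) ^ 2) ^ n)) := by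
  have hL := loopDefectBound_domPK_of_isDatumOfRecord₀ D hD K
  have key : ∀ ω, |loopAt (iterFrom (D.av K) k n (cfg ω)) (walk x w) - 1|
      ≤ 1 / 2 * Real.exp 1 ^ 2 * ((w.length : ℝ) * Λ.card * Dm) ^ 2 * (theta (F.P K) ^ 2) ^ n := fun ω => by
    have h := loopDefect_le_of_support hL (by positivity) (theta_nonneg (F.P K)) hn x w hw (cfg ω)
      (hdom ω) (one_mem_domPK k) Λ (fun b hb => hoff ω b hb) (hDm ω)
    have h0 := loopDefect_nonneg (iterFrom (D.av K) k n (cfg ω)) (walk x w)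
    rw [abs_le]
    constructor <;> linarith
  exact abs_log_integral_exp_sub_le ν₁ ν₂ hG₁ hG₂ (ae_of_all _ key) (ae_of_all _ key) t

/-! ## §4 The near-support cone bound (files 41 ∕ 43 ∕ 48) on the print-kind domains -/

open Classical in
/-- Truncating a `domPrintedPK`-configuration to any bond set (identity elsewhere) stays in `domPrintedPK` (the sup-balls contain `1`).
[bookkeeping] -/
theorem truncate_mem_domPrintedPK {P : Params} {j : ℕ} {V : GaugeField P j (Matrix.specialUnitaryGroup (Fin N) ℂ)}
    (hV : V ∈ domPrintedPK P (Fin N) j) (S : Finset (PBond P j)) :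
    (fun b => if b ∈ S then V b else 1) ∈ domPrintedPK P (Fin N) j := by
  refine ⟨fun b => ?_, fun b => ?_⟩
  · show dist1 (if b ∈ S then V b else 1) ≤ radPK P (Fin N) j
    by_cases hb : b ∈ S
    · rw [if_pos hb]; exact hV.1 b
    · rw [if_neg hb]; exact one_mem_domPK (n := Fin N) j b
  · show dist1 (if b ∈ S then V b else 1) ≤ radPK₂ P (Fin N) j
    by_cases hb : b ∈ S
    · rw [if_pos hb]; exact hV.2 b
    · rw [if_neg hb]; exact one_mem_domPK₂ (n := Fin N) j b

open Classical in
/-- **THE NEAR-SUPPORT DEFECT BOUND FOR THE HEADLINE's CLASS ON PRINT-KIND DOMAINS** (file 43's `loopDefect_le_of_near_support_printed`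
with `domPrinted` replaced by `domPrintedPK ⊇ domPrinted`): for every datum `D` with `D.IsPrintedAveraged`, every cutoff `K`, every closed
walk `w` of `T^{(k+n)}`, every `domPrintedPK`-configuration `V` trivial off `Λ` with one-bond deviations `≤ Dm` on `Λ`: ONLY the bonds of
`Λ` within `(d+2)(L^{k+n} − L^k)` finest units (centre to centre) of the walk are charged —
`1 − W(avgⁿ V) ≤ (e²∕2)·(|w|·|Λ_near|·Dm)²·(θ²)ⁿ`. [bookkeeping] -/
theorem loopDefect_le_of_near_support_printKind (D : FiniteEpsData F (Matrix.specialUnitaryGroup (Fin N) ℂ))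
    (hD : D.IsPrintedAveraged) (K : ℕ) {k n : ℕ} (hn : k + n ≤ (F.P K).m + (F.P K).K)
    (x : Site (F.P K) (k + n)) (w : List (Letter (F.P K).d)) (hw : walkEnd x w = x)
    (V : GaugeField (F.P K) k (Matrix.specialUnitaryGroup (Fin N) ℂ)) (hV : V ∈ domPrintedPK (F.P K) (Fin N) k)
    (Λ ΛD : Finset (PBond (F.P K) k))
    (hΛD : ∀ b, b ∈ ΛD ↔ b ∈ Λ ∧ ∃ s ∈ walk x w,
      Site.tdist (embIter k b.src) (embIter (k + n) s.bond.src)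
        ≤ ((F.P K).d + 2) * ((F.P K).L ^ (k + n) - (F.P K).L ^ k))
    (hoff : ∀ b, b ∉ Λ → V b = 1) {Dm : ℝ} (hDm : ∀ b ∈ Λ, dist1 (V b) ≤ Dm) :
    1 - loopAt (iterFrom (D.av K) k n V) (walk x w)
      ≤ 1 / 2 * Real.exp 1 ^ 2 * ((w.length : ℝ) * ΛD.card * Dm) ^ 2 * (theta (F.P K) ^ 2) ^ n :=
  loopDefect_le_of_near_support (loopDefectBound_of_isPrintedAveraged_printKind D hD K) (by positivity) (theta_pos (F.P K)).le hn
    x w hw V (one_mem_domPrintedPK (n := Fin N) k) Λ ΛD hΛD hoff hDm (truncate_mem_domPrintedPK hV ΛD)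

open Classical in
/-- **… AND AT THE DATUM OF RECORD** (file 48's `loopDefect_le_of_near_support_of_isDatumOfRecord₀` on `domPrintedPK`). [bookkeeping] -/
theorem loopDefect_le_of_near_support_domPrintedPK_of_isDatumOfRecord₀ (D : FiniteEpsData F (Matrix.specialUnitaryGroup (Fin N) ℂ))
    (hD : IsDatumOfRecord₀ F N D) (K : ℕ) {k n : ℕ} (hn : k + n ≤ (F.P K).m + (F.P K).K)
    (x : Site (F.P K) (k + n)) (w : List (Letter (F.P K).d)) (hw : walkEnd x w = x)
    (V : GaugeField (F.P K) k (Matrix.specialUnitaryGroup (Fin N) ℂ)) (hV : V ∈ domPrintedPK (F.P K) (Fin N) k)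
    (Λ ΛD : Finset (PBond (F.P K) k))
    (hΛD : ∀ b, b ∈ ΛD ↔ b ∈ Λ ∧ ∃ s ∈ walk x w,
      Site.tdist (embIter k b.src) (embIter (k + n) s.bond.src)
        ≤ ((F.P K).d + 2) * ((F.P K).L ^ (k + n) - (F.P K).L ^ k))
    (hoff : ∀ b, b ∉ Λ → V b = 1) {Dm : ℝ} (hDm : ∀ b ∈ Λ, dist1 (V b) ≤ Dm) :
    1 - loopAt (iterFrom (D.av K) k n V) (walk x w)
      ≤ 1 / 2 * Real.exp 1 ^ 2 * ((w.length : ℝ) * ΛD.card * Dm) ^ 2 * (theta (F.P K) ^ 2) ^ n :=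
  loopDefect_le_of_near_support_printKind D (isPrintedAveraged_of_isDatumOfRecord₀ F N D hD) K hn x w hw V hV Λ ΛD hΛD hoff hDm

end Summit.QuantumFields.BalabanUV.T4Continuum.Spine.NE7

end
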